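import Summits.QuantumFields.YangMills.Theorems.SoloBlindOddTorusSlabDecay
import Summits.QuantumFields.YangMills.Theorems.SoloBlindSpeciesSlab
import Summits.QuantumFields.YangMills.Theorems.SoloBlindLatticeGapReflected
import HarnessLib

/-!
# A PURE two-point floor forces a floor on the OS-diagonal (reflected) correlator
# (solo-QuantumFields-blind, rung D21)

`Summit.QuantumFields.YangMills.Theorems.SoloBlindReflectedFloor` (read-only conjunct `YangMills`).
Write `Θ A := A.timeReflect` and `c_{A,B}(S; n) := latticeConnectedCorr ρ β (2S+1) A B n`.

**Why this file exists (erratum to this unit's reading of the Statement, s26).**  The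
log-convex, nonnegative lattice sequences produced by reflection positivity (parts 8–10 of rung
D8) are the OS-DIAGONAL ones, `n ↦ c_{ΘA,A}(S; n)` and `n ↦ c_{A,ΘA}(S; n)` along odd `n`; the
two-time ratio floor of rungs D18/D19 (`HasRatioFloorOnSchemeTori`) is a hypothesis on such a
sequence.  The clause `IsYangMillsFor r sch T` of the conjunct, however, controls continuum
limits of correlators of the CURVATURE species with ITSELF (label `r.curvature`); the curvature
species (Wilson's corner action density: magnetic plus electric plaquettes through the origin) is
not reflection covariant — the site reflection fixes the magnetic corner plaquettes and reads the
electric ones one lattice step down (tree: `actionDensity_cfgReflect`,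
`Literature/…/ActionDensityTimeReflection.lean`) — so for a curvature smearing `H` the
OS-diagonal sequence `c_{ΘH,H}` is a MIXED correlator whose renormalisation (label `ΘH`) is
witness data, not fed by the Statement.  What
the Statement does feed, for every witness, is a floor on the PURE correlator `c_{H,H}` at a
physical lag (nonzero truncated continuum two-point function).  This file records what
reflection positivity makes of a pure floor, with its constant:

* `sq_latticeConnectedCorr_le_reflected` — the OS Schwarz inequality in species language on the
  odd torus `2S+1`, `β ≥ 0`: `c_{A,B}(S; t+t'-1)² ≤ c_{A,ΘA}(S; 2t-1) · c_{ΘB,B}(S; 2t'-1)` for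
  slab species and admissible `t, t'`; in particular (`B = A`, `t' = t`)
  `c_{A,A}(S; 2t-1)² ≤ c_{A,ΘA}(S; 2t-1) · c_{ΘA,A}(S; 2t-1)` (`sq_latticeConnectedCorr_diag_le`);
* `latticeConnectedCorr_reflected_odd_nonneg`, `latticeConnectedCorr_reflected_odd_nonneg'` —
  `0 ≤ c_{ΘA,A}(S; 2n+1)`, `0 ≤ c_{A,ΘA}(S; 2n+1)` at admissible odd lags;
* `sq_latticeConnectedCorr_le_reflected_mul_sup` — with `|A| ≤ a`:
  `c_{A,A}(S; 2t-1)² ≤ 2a² · c_{ΘA,A}(S; 2t-1)` (and the mirror statement): a pure floor `η`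
  forces the OS-diagonal floor `η²/(2a²)`;
* `schemeTori_reflected_floor`, `schemeTori_reflected_ratio` — scheme level, on the scheme's own
  tori `S = L_k`, for a `k`-dependent family of `[-T', T]`-slab species `A_k` with `|A_k| ≤ a_k`
  and a pure floor `η ≤ c_{A_k,A_k}(L_k; 2t₂(k)-1)` eventually:
  `η² ≤ 2a_k² · c_{ΘA_k,A_k}(L_k; 2t₂(k)-1)` and the two-time RATIO floor
  `η² · c_{ΘA_k,A_k}(L_k; 2t₁(k)-1) ≤ 4a_k⁴ · c_{ΘA_k,A_k}(L_k; 2t₂(k)-1)` eventually.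

Consequence recorded in prose only (paper/obstruction.md §1, referee-notes 63): for spatial
smearings `H_k = c_k a_k³ Σ h(a_k x) curv(· + x)` of the curvature species (`a_k`-sup of order
`c_k ‖h‖₁`), the ratio is `ϑ_k ≍ η² / c_k⁴`, so the slope-pinning rate that log-convexity then
yields is `κ_k = (4 log c_k + O(1))/τ` — a genuine but degenerate Statement-level bound
(correlation length `≳ τ/(a_k log c_k)` lattice units on the witness's own torus), which is the
rate `κ a_k` of rung D19 only for witnesses that renormalise a reflection-COVARIANT (time-zero
spatial) species nontrivially; the Statement does not require that.  The parity-class one-step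
envelope for slab families is not in this file.  No decay or floor is produced here.
[folklore: Schwarz inequality of the OS form, Seiler LNP 159 Ch. 2; Osterwalder–Seiler 1978 §2;
the bookkeeping is this unit's]
-/

open Filter MeasureTheory
open Literature.MathematicalPhysics.QuantumFieldTheory Literature.MathematicalPhysics.QuantumLattice

noncomputable section

namespace Summit.QuantumFields.YangMills.Theorems.SoloBlind

variable {G : Type} [Group G] [TopologicalSpace G] [IsTopologicalGroup G] [CompactSpace G]
  [MeasurableSpace G] [BorelSpace G]

/-! ### Torus level: the OS Schwarz inequality in species language -/

section Torus

variable {N : ℕ} (ρ : G →* Matrix (Fin N) (Fin N) ℂ) (hρ : Continuous ρ) {β : ℝ} (hβ : 0 ≤ β)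
  (S : ℕ)

include hρ hβ in
/-- **OS Schwarz inequality in species language** (odd torus `2S+1`, `β ≥ 0`, any compact `G`):
for a `[-T'_A, T_A]`-slab species `A` and a `[-T'_B, T_B]`-slab species `B`,
`c_{A,B}(S; t+t'-1)² ≤ c_{A,ΘA}(S; 2t-1) · c_{ΘB,B}(S; 2t'-1)` whenever
`T_A + 1 ≤ t ≤ S - T'_A` and `T'_B + 1 ≤ t' ≤ S - T_B`.
[folklore: Seiler LNP 159 Ch. 2; dictionaries of rung D8 part 10] -/
theorem sq_latticeConnectedCorr_le_reflected (A B : YMSpecies G) {T'A TA T'B TB : ℕ}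
    (hA : IsSlabSupported T'A TA A) (hB : IsSlabSupported T'B TB B) {t t' : ℕ}
    (ht1 : TA + 1 ≤ t) (ht2 : t + T'A ≤ S) (ht'1 : T'B + 1 ≤ t') (ht'2 : t' + TB ≤ S) :
    latticeConnectedCorr ρ β (2 * S + 1) A.F B.F (t + t' - 1) ^ 2 ≤
      latticeConnectedCorr ρ β (2 * S + 1) A.F A.timeReflect.F (2 * t - 1) *
        latticeConnectedCorr ρ β (2 * S + 1) B.timeReflect.F B.F (2 * t' - 1) := by
  have hS1 : 1 ≤ S := by omega
  obtain ⟨a0, ha0⟩ := A.bounded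
  obtain ⟨b0, hb0⟩ := B.bounded
  -- the centred torus observables `FA = Â_c ∘ Θ'` (a `[-T_A, T'_A]`-slab) and `FB = B̂_c`
  set FA : GaugeConfig 4 (2 * S + 1) G → ℝ := fun U =>
    toTorusObservable (2 * S + 1) A.F U.negReflect -
      wilsonExpectation ρ β (toTorusObservable (2 * S + 1) A.F) with hFA
  set FB : GaugeConfig 4 (2 * S + 1) G → ℝ := fun U =>
    toTorusObservable (2 * S + 1) B.F U -
      wilsonExpectation ρ β (toTorusObservable (2 * S + 1) B.F) with hFB
  have hAm : Measurable FA :=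
    ((A.measurable.comp (measurable_torusLift (2 * S + 1))).comp
      WilsonSiteRP.measurable_negReflect).sub_const _
  have hBm : Measurable FB := (B.measurable.comp (measurable_torusLift (2 * S + 1))).sub_const _
  have hAb : ∃ C : ℝ, ∀ U, |FA U| ≤ C :=
    ⟨a0 + |wilsonExpectation ρ β (toTorusObservable (2 * S + 1) A.F)|, fun U =>
      (abs_sub _ _).trans (by gcongr; rw [toTorusObservable_apply]; exact ha0 _)⟩
  have hBb : ∃ C : ℝ, ∀ U, |FB U| ≤ C :=
    ⟨b0 + |wilsonExpectation ρ β (toTorusObservable (2 * S + 1) B.F)|, fun U =>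
      (abs_sub _ _).trans (by gcongr; rw [toTorusObservable_apply]; exact hb0 _)⟩
  have hAs : DependsOn FA (slabEdges TA T'A) :=
    dependsOn_toTorusObservable_negReflect_slab (by omega) (by omega) hS1 A hA _
  have hBs : DependsOn FB (slabEdges T'B TB) :=
    dependsOn_toTorusObservable_slab (by omega) (by omega) B hB _
  -- OS Schwarz with the slices `t, t'`
  have hLodd : Odd (2 * S + 1) := ⟨S, rfl⟩
  have hdiv : (2 * S + 1) / 2 = S := by omega
  have hv : ((t : ℕ) : ZMod (2 * S + 1)).val = t := by
    rw [ZMod.val_natCast]; exact Nat.mod_eq_of_lt (by omega)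
  have hv' : ((t' : ℕ) : ZMod (2 * S + 1)).val = t' := by
    rw [ZMod.val_natCast]; exact Nat.mod_eq_of_lt (by omega)
  have h := osPairing_schwarz ρ hLodd (by omega) hρ hβ hAm hAb hAs hBm hBb hBs
    (t := ((t : ℕ) : ZMod (2 * S + 1))) (t' := ((t' : ℕ) : ZMod (2 * S + 1)))
    (by rw [hv]; omega) (by rw [hv, hdiv]; omega) (by rw [hv']; omega)
    (by rw [hv', hdiv]; omega)
  have c1 : ((t : ℕ) : ZMod (2 * S + 1)) + ((t' : ℕ) : ZMod (2 * S + 1)) - 1 =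
      ((t + t' - 1 : ℕ) : ZMod (2 * S + 1)) := by
    rw [Nat.cast_sub (by omega)]; push_cast; ring
  have c2 : (2 : ZMod (2 * S + 1)) * ((t : ℕ) : ZMod (2 * S + 1)) - 1 =
      ((2 * t - 1 : ℕ) : ZMod (2 * S + 1)) := by
    rw [Nat.cast_sub (by omega)]; push_cast; ring
  have c3 : (2 : ZMod (2 * S + 1)) * ((t' : ℕ) : ZMod (2 * S + 1)) - 1 =
      ((2 * t' - 1 : ℕ) : ZMod (2 * S + 1)) := by
    rw [Nat.cast_sub (by omega)]; push_cast; ring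
  rw [c1, c2, c3] at h
  rw [latticeConnectedCorr_eq_osPairingSeq ρ hρ β S A B (t + t' - 1),
    ← osPairingSeq_centred_negReflect_eq ρ hρ β S A (2 * t - 1),
    ← osPairingSeq_centred_eq ρ hρ β S B (2 * t' - 1)]
  exact h

include hρ hβ in
/-- The diagonal case: `c_{A,A}(S; 2t-1)² ≤ c_{A,ΘA}(S; 2t-1) · c_{ΘA,A}(S; 2t-1)` for a
`[-T', T]`-slab species and `max T T' + 1 ≤ t ≤ S - max T T'`.  The two factors on the right
are the OS-DIAGONAL correlators; the left side is the PURE one. [folklore] -/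
theorem sq_latticeConnectedCorr_diag_le (A : YMSpecies G) {T' T : ℕ} (hA : IsSlabSupported T' T A)
    {t : ℕ} (ht1 : max T T' + 1 ≤ t) (ht2 : t + max T T' ≤ S) :
    latticeConnectedCorr ρ β (2 * S + 1) A.F A.F (2 * t - 1) ^ 2 ≤
      latticeConnectedCorr ρ β (2 * S + 1) A.F A.timeReflect.F (2 * t - 1) *
        latticeConnectedCorr ρ β (2 * S + 1) A.timeReflect.F A.F (2 * t - 1) := by
  have h := sq_latticeConnectedCorr_le_reflected ρ hρ hβ S A A hA hA (t := t) (t' := t)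
    (by omega) (by omega) (by omega) (by omega)
  rwa [show t + t - 1 = 2 * t - 1 by omega] at h

include hρ hβ in
/-- `0 ≤ c_{ΘA,A}(S; 2n+1)` for a `[-T', T]`-slab species, `T' ≤ n`, `n + 1 + T ≤ S`
(reflection positivity at odd separations). [folklore] -/
theorem latticeConnectedCorr_reflected_odd_nonneg (A : YMSpecies G) {T' T : ℕ}
    (hA : IsSlabSupported T' T A) {n : ℕ} (hn1 : T' ≤ n) (hn2 : n + 1 + T ≤ S) :
    0 ≤ latticeConnectedCorr ρ β (2 * S + 1) A.timeReflect.F A.F (2 * n + 1) := by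
  obtain ⟨b0, hb0⟩ := A.bounded
  set FB : GaugeConfig 4 (2 * S + 1) G → ℝ := fun U =>
    toTorusObservable (2 * S + 1) A.F U -
      wilsonExpectation ρ β (toTorusObservable (2 * S + 1) A.F) with hFB
  have hBm : Measurable FB := (A.measurable.comp (measurable_torusLift (2 * S + 1))).sub_const _
  have hBb : ∃ C : ℝ, ∀ U, |FB U| ≤ C :=
    ⟨b0 + |wilsonExpectation ρ β (toTorusObservable (2 * S + 1) A.F)|, fun U =>
      (abs_sub _ _).trans (by gcongr; rw [toTorusObservable_apply]; exact hb0 _)⟩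
  have hBs : DependsOn FB (slabEdges T' T) :=
    dependsOn_toTorusObservable_slab (by omega) (by omega) A hA _
  have h := osPairingSeq_odd_nonneg ρ (L := 2 * S + 1) (m := S) rfl (by omega) hρ hβ hBm hBb hBs
    (n := n) hn1 hn2
  rwa [osPairingSeq_centred_eq ρ hρ β S A (2 * n + 1)] at h

include hρ hβ in
/-- `0 ≤ c_{A,ΘA}(S; 2n+1)` for a `[-T', T]`-slab species, `T ≤ n`, `n + 1 + T' ≤ S`, `1 ≤ S`
(the reflected observable is a `[-T, T']`-slab observable). [folklore] -/
theorem latticeConnectedCorr_reflected_odd_nonneg' (A : YMSpecies G) {T' T : ℕ}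
    (hA : IsSlabSupported T' T A) {n : ℕ} (hn1 : T ≤ n) (hn2 : n + 1 + T' ≤ S) (hS1 : 1 ≤ S) :
    0 ≤ latticeConnectedCorr ρ β (2 * S + 1) A.F A.timeReflect.F (2 * n + 1) := by
  obtain ⟨a0, ha0⟩ := A.bounded
  set FA : GaugeConfig 4 (2 * S + 1) G → ℝ := fun U =>
    toTorusObservable (2 * S + 1) A.F U.negReflect -
      wilsonExpectation ρ β (toTorusObservable (2 * S + 1) A.F) with hFA
  have hAm : Measurable FA :=
    ((A.measurable.comp (measurable_torusLift (2 * S + 1))).comp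
      WilsonSiteRP.measurable_negReflect).sub_const _
  have hAb : ∃ C : ℝ, ∀ U, |FA U| ≤ C :=
    ⟨a0 + |wilsonExpectation ρ β (toTorusObservable (2 * S + 1) A.F)|, fun U =>
      (abs_sub _ _).trans (by gcongr; rw [toTorusObservable_apply]; exact ha0 _)⟩
  have hAs : DependsOn FA (slabEdges T T') :=
    dependsOn_toTorusObservable_negReflect_slab (by omega) (by omega) hS1 A hA _
  have h := osPairingSeq_odd_nonneg ρ (L := 2 * S + 1) (m := S) rfl (by omega) hρ hβ hAm hAb hAs
    (n := n) hn1 hn2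
  rwa [osPairingSeq_centred_negReflect_eq ρ hρ β S A (2 * n + 1)] at h

include hρ hβ in
/-- **A pure floor forces the OS-diagonal floor, with its constant.**  For a `[-T', T]`-slab
species with `|A| ≤ a` and `max T T' + 1 ≤ t ≤ S - max T T'`:
`c_{A,A}(S; 2t-1)² ≤ 2a² · c_{ΘA,A}(S; 2t-1)`.  (Schwarz, `c_{A,ΘA} ≤ 2a²` trivially, and
`c_{ΘA,A}(S; 2t-1) ≥ 0`.)  So `η ≤ c_{A,A}` forces `c_{ΘA,A} ≥ η²/(2a²)` — the sup constant of the
observable enters, and for renormalised smearings it grows with the field-strength constant.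
[this unit's bookkeeping; elementary] -/
theorem sq_latticeConnectedCorr_le_reflected_mul_sup (A : YMSpecies G) {T' T : ℕ}
    (hA : IsSlabSupported T' T A) {a : ℝ} (ha : ∀ U, |A.F U| ≤ a) {t : ℕ}
    (ht1 : max T T' + 1 ≤ t) (ht2 : t + max T T' ≤ S) :
    latticeConnectedCorr ρ β (2 * S + 1) A.F A.F (2 * t - 1) ^ 2 ≤
      2 * (a * a) * latticeConnectedCorr ρ β (2 * S + 1) A.timeReflect.F A.F (2 * t - 1) := by
  have ha' : ∀ U, |A.timeReflect.F U| ≤ a := fun U => by simpa using ha (cfgReflect U)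
  have h1 := sq_latticeConnectedCorr_diag_le ρ hρ hβ S A hA ht1 ht2
  have h2 : latticeConnectedCorr ρ β (2 * S + 1) A.F A.timeReflect.F (2 * t - 1) ≤ 2 * (a * a) :=
    (le_abs_self _).trans (abs_latticeConnectedCorr_le ρ hρ β S A A.timeReflect ha ha' _)
  have h3 : 0 ≤ latticeConnectedCorr ρ β (2 * S + 1) A.timeReflect.F A.F (2 * t - 1) := by
    have h := latticeConnectedCorr_reflected_odd_nonneg ρ hρ hβ S A hA (n := t - 1) (by omega)
      (by omega)
    rwa [show 2 * (t - 1) + 1 = 2 * t - 1 by omega] at h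
  exact h1.trans (mul_le_mul_of_nonneg_right h2 h3)

include hρ hβ in
/-- The mirror statement: `c_{A,A}(S; 2t-1)² ≤ 2a² · c_{A,ΘA}(S; 2t-1)`. [elementary] -/
theorem sq_latticeConnectedCorr_le_reflected_mul_sup' (A : YMSpecies G) {T' T : ℕ}
    (hA : IsSlabSupported T' T A) {a : ℝ} (ha : ∀ U, |A.F U| ≤ a) {t : ℕ}
    (ht1 : max T T' + 1 ≤ t) (ht2 : t + max T T' ≤ S) :
    latticeConnectedCorr ρ β (2 * S + 1) A.F A.F (2 * t - 1) ^ 2 ≤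
      2 * (a * a) * latticeConnectedCorr ρ β (2 * S + 1) A.F A.timeReflect.F (2 * t - 1) := by
  have ha' : ∀ U, |A.timeReflect.F U| ≤ a := fun U => by simpa using ha (cfgReflect U)
  have h1 := sq_latticeConnectedCorr_diag_le ρ hρ hβ S A hA ht1 ht2
  have h2 : latticeConnectedCorr ρ β (2 * S + 1) A.timeReflect.F A.F (2 * t - 1) ≤ 2 * (a * a) :=
    (le_abs_self _).trans (abs_latticeConnectedCorr_le ρ hρ β S A.timeReflect A ha' ha _)
  have h3 : 0 ≤ latticeConnectedCorr ρ β (2 * S + 1) A.F A.timeReflect.F (2 * t - 1) := by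
    have h := latticeConnectedCorr_reflected_odd_nonneg' ρ hρ hβ S A hA (n := t - 1) (by omega)
      (by omega) (by omega)
    rwa [show 2 * (t - 1) + 1 = 2 * t - 1 by omega] at h
  rw [mul_comm (latticeConnectedCorr ρ β (2 * S + 1) A.F A.timeReflect.F (2 * t - 1))] at h1
  exact h1.trans (mul_le_mul_of_nonneg_right h2 h3)

end Torus

/-! ### Scheme level: the floors on the scheme's own tori `S = L_k` -/

section Scheme

variable (r : LatticeRep G) {sch : SpeciesScheme (YMSpecies G)}

/-- **Pure floor ⇒ OS-diagonal floor on the scheme's tori.**  Let `A_k` be `[-T', T]`-slab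
species with `|A_k| ≤ a_k`, and let `t₂(k)` be admissible slices
(`max T T' + 1 ≤ t₂(k) ≤ L_k - max T T'` eventually).  If the PURE correlator has the floor
`η ≤ c_{A_k,A_k}(L_k; 2t₂(k)-1)` eventually (`η ≥ 0`) — this is what a nonzero truncated
continuum two-point function of the species' own label delivers — then eventually
`η² ≤ 2a_k² · c_{ΘA_k,A_k}(L_k; 2t₂(k)-1)`. [this unit's; elementary] -/
theorem schemeTori_reflected_floor (hw : sch.HasWeakCouplingLimit) (A : ℕ → YMSpecies G)
    {T' T : ℕ} (hA : ∀ k, IsSlabSupported T' T (A k)) (a : ℕ → ℝ)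
    (ha : ∀ k U, |(A k).F U| ≤ a k) (t₂ : ℕ → ℕ) (ht₂ : ∀ᶠ k in atTop, max T T' + 1 ≤ t₂ k)
    (ht₂' : ∀ᶠ k in atTop, t₂ k + max T T' ≤ sch.L k) {η : ℝ} (hη : 0 ≤ η)
    (hfloor : ∀ᶠ k in atTop,
      η ≤ latticeConnectedCorr r.ρ (sch.β k) (2 * sch.L k + 1) (A k).F (A k).F (2 * t₂ k - 1)) :
    ∀ᶠ k in atTop, η ^ 2 ≤ 2 * (a k * a k) *
      latticeConnectedCorr r.ρ (sch.β k) (2 * sch.L k + 1) (A k).timeReflect.F (A k).F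
        (2 * t₂ k - 1) := by
  filter_upwards [hfloor, ht₂, ht₂', eventually_beta_nonneg hw] with k hk h1 h2 hβk
  exact (pow_le_pow_left₀ hη hk 2).trans
    (sq_latticeConnectedCorr_le_reflected_mul_sup r.ρ r.continuous hβk (sch.L k) (A k) (hA k)
      (ha k) h1 h2)

/-- **Pure floor ⇒ two-time RATIO floor for the OS-diagonal sequence, with its constant.**  In the
setting of `schemeTori_reflected_floor`, for any admissible earlier (or other) slices `t₁(k)`:
eventually `η² · c_{ΘA_k,A_k}(L_k; 2t₁(k)-1) ≤ 4a_k⁴ · c_{ΘA_k,A_k}(L_k; 2t₂(k)-1)` — i.e. the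
ratio floor `ϑ_k = η²/(4a_k⁴)` of rungs D18/D19, now with the `k`-dependence that a
non-reflection-covariant species (the curvature) cannot avoid at Statement level.
[this unit's; elementary] -/
theorem schemeTori_reflected_ratio (hw : sch.HasWeakCouplingLimit) (A : ℕ → YMSpecies G)
    {T' T : ℕ} (hA : ∀ k, IsSlabSupported T' T (A k)) (a : ℕ → ℝ)
    (ha : ∀ k U, |(A k).F U| ≤ a k) (t₁ t₂ : ℕ → ℕ)
    (ht₂ : ∀ᶠ k in atTop, max T T' + 1 ≤ t₂ k) (ht₂' : ∀ᶠ k in atTop, t₂ k + max T T' ≤ sch.L k)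
    {η : ℝ} (hη : 0 ≤ η)
    (hfloor : ∀ᶠ k in atTop,
      η ≤ latticeConnectedCorr r.ρ (sch.β k) (2 * sch.L k + 1) (A k).F (A k).F (2 * t₂ k - 1)) :
    ∀ᶠ k in atTop,
      η ^ 2 * latticeConnectedCorr r.ρ (sch.β k) (2 * sch.L k + 1) (A k).timeReflect.F (A k).F
          (2 * t₁ k - 1) ≤
        4 * (a k) ^ 4 * latticeConnectedCorr r.ρ (sch.β k) (2 * sch.L k + 1)
          (A k).timeReflect.F (A k).F (2 * t₂ k - 1) := by
  filter_upwards [schemeTori_reflected_floor r hw A hA a ha t₂ ht₂ ht₂' hη hfloor]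
    with k hk
  have ha' : ∀ U, |(A k).timeReflect.F U| ≤ a k := fun U => by simpa using ha k (cfgReflect U)
  have hup : latticeConnectedCorr r.ρ (sch.β k) (2 * sch.L k + 1) (A k).timeReflect.F (A k).F
      (2 * t₁ k - 1) ≤ 2 * (a k * a k) :=
    (le_abs_self _).trans (abs_latticeConnectedCorr_le r.ρ r.continuous (sch.β k) (sch.L k)
      (A k).timeReflect (A k) ha' (ha k) _)
  have hη2 : 0 ≤ η ^ 2 := sq_nonneg η
  have haa : 0 ≤ 2 * (a k * a k) := mul_nonneg two_pos.le (mul_self_nonneg _)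
  calc η ^ 2 * latticeConnectedCorr r.ρ (sch.β k) (2 * sch.L k + 1) (A k).timeReflect.F (A k).F
          (2 * t₁ k - 1)
      ≤ η ^ 2 * (2 * (a k * a k)) := mul_le_mul_of_nonneg_left hup hη2
    _ ≤ (2 * (a k * a k) * latticeConnectedCorr r.ρ (sch.β k) (2 * sch.L k + 1)
          (A k).timeReflect.F (A k).F (2 * t₂ k - 1)) * (2 * (a k * a k)) :=
        mul_le_mul_of_nonneg_right hk haa
    _ = 4 * (a k) ^ 4 * latticeConnectedCorr r.ρ (sch.β k) (2 * sch.L k + 1)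
          (A k).timeReflect.F (A k).F (2 * t₂ k - 1) := by ring

end Scheme

end Summit.QuantumFields.YangMills.Theorems.SoloBlind

end
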